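import Literature.AlgebraicGeometry.Motives.GrothendieckExistenceWittReduction
import Literature.AlgebraicGeometry.Morphisms.FormalModuleProjective
import Literature.AlgebraicGeometry.Modules.CohFinitePresentation
import Literature.AlgebraicGeometry.Crystalline.BlochEsnaultKerzLifting
import HarnessLib

/-!
# Grothendieck's existence theorem for vector bundles on a PROJECTIVE `W(k)`-scheme (proved)

Görtz–Wedhorn, *Algebraic Geometry II* (2023), Thm. 24.94 (Grothendieck's existence theorem,
= EGA III₁ Thm. 5.1.4) with Prop. 24.95 (finite locally free modules correspond) in the PROJECTIVE
case (Lemma 24.103, p. 570; EGA III₁ Cor. 5.2.4; Stacks 0885), for the base `A = W(k)`, `k` a perfect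
field of characteristic `p`, `I = (p)`:

**for a `W(k)`-scheme `𝒳` admitting a closed `W(k)`-immersion into some `ℙʳ_{W(k)}`, every compatible
system `(E_n)_n` of vector bundles on the thickenings `X_{n+1} = 𝒳 ⊗_W W/pⁿ⁺¹` (`E_{n+1}|_{X_{n+1}} ≅ E_n`)
is the system of restrictions of a vector bundle `F` on `𝒳`: `F|_{X_{n+1}} ≅ E_n` for every `n`**
(`exists_isVectorBundle_forall_pullback_thickeningι_iso_of_isClosedImmersion_PP`, and its
`Crystalline.IsProjectiveOverRing` form `…_of_isProjectiveOverRing`).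

This is the statement of the tree's NAMED FACTS
`Literature.AlgebraicGeometry.Motives.GrothendieckExistence_vectorBundle_witt` (level `1`) and
`Literature.AlgebraicGeometry.Deformation.GortzWedhorn2023_thm2494_vectorBundle_witt` (all levels)
RESTRICTED TO PROJECTIVE `𝒳` — proved here with no hypothesis, by assembling tree theorems:

* the dictionary restriction model ⇄ quotient model of `Motives/GrothendieckExistenceWittTower`
  (`coh_tower_of_formalVectorBundle`: the direct images `M_n = ι_{n+1*}E_n` form a tower of coherent
  `𝒪_𝒳`-modules with `pⁿ⁺¹M_n = 0`, `M_{n+1}/pⁿ⁺¹ ≅ M_n`; `isVectorBundle_and_iso_of_cokernelIsos`,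
  `pullbackThickeningιIso`: a finitely presented `G` with `G/pⁿ⁺¹G ≅ M_n` is a vector bundle with
  `ι_{n+1}^*G ≅ E_n` — the algebraic half of Prop. 24.95 with Lemma 24.96,
  `FormalGeometry/LocallyFreeOfThickenings`);
* the formal-tower packaging `towerOfIsos` / `IsFormalTower.ofIsos` (`Morphisms/FormalModuleTower`);
* **the projective case of the existence theorem for coherent formal modules**,
  `Morphisms.exists_coh_levelwise_iso_of_isClosedImmersion_PP` (`Morphisms/FormalModuleProjective`:
  GW II Lemma 24.103 — uniform Serre vanishing, Artin–Rees, Lemma 24.101 (1)), applied with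
  `A = W(k)` (Noetherian: Mathlib `WittVector.isDiscreteValuationRing`; `p`-adically complete: Mathlib
  `WittVector.isAdicCompleteIdealSpanP`) and `a = p`;
* `Modules.isFinitePresentation_of_coh` (coherent ⇒ finitely presented on the locally Noetherian `𝒳`).

Consequences recorded (all proved): `liftsTo_of_liftsFormally_of_isProjectiveOverRing`
(`WittScheme.LiftsFormally 𝒳 E₁ → WittScheme.LiftsTo 𝒳 E₁` for projective `𝒳`: "Grothendieck's formal
existence theorem gives an algebraization", Bloch–Esnault–Kerz 2014 §1 (1.3), at the level of vector
bundles), and the bodies of the two named facts / of route item stmt-HodgeConjecture-14106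
(`PadicSemiregularLift.FormalVectorBundlesAlgebraize`) under the extra hypothesis
`Crystalline.IsProjectiveOverRing 𝒳` (`grothendieckExistence_vectorBundle_witt_of_isProjectiveOverRing`
for the level-`1` form, `exists_isVectorBundle_forall_pullback_thickeningι_iso_of_isProjectiveOverRing`
for the all-levels form of `Deformation/GrothendieckExistenceVectorBundles`,
`formalVectorBundlesAlgebraize_of_isProjectiveOverRing` for the route item). The general PROPER case (Chow's lemma and
noetherian induction, GW II 24.104–24.106) is not addressed here.

Everything is proved; no named facts.

## References

* U. Görtz, T. Wedhorn, *Algebraic Geometry II: Cohomology of Schemes*, Springer Spektrum (2023),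
  doi:10.1007/978-3-658-43031-3: Thm. 24.94, Prop. 24.95, Lemma 24.96 (p. 566), Lemma 24.103 (p. 570).
  [GortzWedhorn2023]
* A. Grothendieck, EGA III₁ (Publ. Math. IHÉS 11, 1961), Thm. 5.1.4, Cor. 5.2.4. [EGAIII1]
* S. Bloch, H. Esnault, M. Kerz, *p-adic deformation of algebraic cycle classes*, Invent. Math. 195
  (2014), §1 (1.3). [BlochEsnaultKerz2014pAdic]
* The Stacks Project, Tag 0885. [StacksProject]
-/

noncomputable section

open CategoryTheory AlgebraicGeometry Limits
open Literature.AlgebraicGeometry.Modules Literature.AlgebraicGeometry.Morphisms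
open Literature.AlgebraicGeometry.Morphisms.ProjCech

universe u

namespace Literature.AlgebraicGeometry.Motives

open WittScheme

variable {p : ℕ} [Fact p.Prime] {k : Type u} [Field k] [CharP k p] [PerfectRing k p]

/-- **Grothendieck's existence theorem for vector bundles, projective case (GW II Thm. 24.94 +
Prop. 24.95 via Lemma 24.103), over `W(k)` with `k` perfect.** Let `𝒳` be a `W(k)`-scheme with a
closed immersion `ι : 𝒳 → ℙʳ_{W(k)}` over `W(k)`, and let `E_n` be vector bundles on the thickenings
`X_{n+1} = 𝒳 ⊗ W/pⁿ⁺¹` with `E_{n+1}|_{X_{n+1}} ≅ E_n`. Then there is a vector bundle `F` on `𝒳` with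
`F|_{X_{n+1}} ≅ E_n` for all `n`. Proof: the direct images `M_n = ι_{n+1*}E_n` form a formal tower of
coherent `𝒪_𝒳`-modules along `p` (`coh_tower_of_formalVectorBundle`); by the projective existence
theorem for coherent formal modules (`exists_coh_levelwise_iso_of_isClosedImmersion_PP`) it is
levelwise `G/pⁿ⁺¹G` for a coherent `G`; such a `G` is a vector bundle with `ι_{n+1}^*G ≅ E_n`
(`isVectorBundle_and_iso_of_cokernelIsos`, `pullbackThickeningιIso`).
[cite: GortzWedhorn2023, Thm 24.94, Prop 24.95 (p. 566) and Lemma 24.103 (p. 570)]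
[cite: EGAIII1, Thm 5.1.4 and Cor 5.2.4] -/
theorem exists_isVectorBundle_forall_pullback_thickeningι_iso_of_isClosedImmersion_PP
    (𝒳 : SchemeOver (WittVector p k)) {r : ℕ} (ι : 𝒳.left ⟶ PP (WittVector p k) r)
    [IsClosedImmersion ι] (w : ι ≫ toSpec (WittVector p k) r = 𝒳.hom)
    (E : ∀ n : ℕ, (thickening 𝒳 (n + 1)).left.Modules) (hE : ∀ n, IsVectorBundle (E n))
    (hcompat : ∀ n, Nonempty ((Scheme.Modules.pullback
      (thickeningMap 𝒳 (Nat.le_succ (n + 1)))).obj (E (n + 1)) ≅ E n)) :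
    ∃ F : 𝒳.left.Modules, IsVectorBundle F ∧
      ∀ n : ℕ, Nonempty ((Scheme.Modules.pullback (thickeningι 𝒳 (n + 1))).obj F ≅ E n) := by
  have hw : strZ ι = 𝒳.hom := w
  haveI : IsProper (toSpec (WittVector p k) r) :=
    ProjBaseChangeRing.isProper_projToSpec (Fin (r + 1)) (WittVector p k)
  haveI : IsProper 𝒳.hom := by rw [← w]; infer_instance
  haveI : IsLocallyNoetherian 𝒳.left := isLocallyNoetherian_of_isClosedImmersion_PP ι
  -- the direct-image tower `M_n = ι_{n+1*} E_n` in the quotient model, along `a = p`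
  obtain ⟨hcoh, hkill, htrans⟩ := coh_tower_of_formalVectorBundle 𝒳 E hE hcompat
  have hpow : ∀ m, algebraMapΓ 𝒳.hom ((p : WittVector p k) ^ m) =
      algebraMapΓ 𝒳.hom (p : WittVector p k) ^ m := algebraMapΓ_pow 𝒳
  let M : ℕ → 𝒳.left.Modules := fun n =>
    (Scheme.Modules.pushforward (thickeningι 𝒳 (n + 1))).obj (E n)
  let β : ∀ n, cokernel (globalScalar (M (n + 1))
      (algebraMapΓ 𝒳.hom (p : WittVector p k) ^ (n + 1))) ≅ M n := fun n =>
    cokernelIsoOfEq (by rw [hpow]) ≪≫ (htrans n).some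
  have hk' : ∀ n, globalScalar (M n) (algebraMapΓ 𝒳.hom (p : WittVector p k) ^ (n + 1)) = 0 :=
    fun n => by rw [← hpow]; exact hkill n
  have hT : IsFormalTower (algebraMapΓ (strZ ι) (p : WittVector p k))
      (towerOfIsos (algebraMapΓ 𝒳.hom (p : WittVector p k)) M β) := by
    rw [hw]; exact IsFormalTower.ofIsos _ M β hk'
  have hTc : ∀ n, Coh ((towerOfIsos (algebraMapΓ 𝒳.hom (p : WittVector p k)) M β).obj ⟨n⟩) :=
    fun n => hcoh n
  -- the projective existence theorem for coherent formal modules (GW II Lemma 24.103)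
  obtain ⟨G, hG, e⟩ := exists_coh_levelwise_iso_of_isClosedImmersion_PP (p : WittVector p k) ι hT hTc
  have hGfp : SheafOfModules.IsFinitePresentation.{u, u, u} G := isFinitePresentation_of_coh G hG
  -- levelwise: `G/pⁿ⁺¹G ≅ ι_{n+1*} E_n`
  have β' : ∀ n, cokernel (globalScalar G (algebraMapΓ 𝒳.hom ((p : WittVector p k) ^ (n + 1)))) ≅
      (Scheme.Modules.pushforward (thickeningι 𝒳 (n + 1))).obj (E n) := fun n =>
    cokernelIsoOfEq (by rw [hpow, hw]) ≪≫ (e n).some.symm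
  -- back to the restriction model
  obtain ⟨hGvb, -⟩ := isVectorBundle_and_iso_of_cokernelIsos 𝒳 E hE G hGfp β'
  exact ⟨G, hGvb, fun n => ⟨pullbackThickeningιIso (n + 1) G (β' n)⟩⟩

/-- **Grothendieck's existence theorem for vector bundles on a projective `W(k)`-scheme**
(`Crystalline.IsProjectiveOverRing 𝒳`: a closed `W(k)`-immersion into some `ℙʳ_{W(k)}`), `k` perfect:
every compatible system of vector bundles on the thickenings `𝒳 ⊗ W/pⁿ⁺¹` is the system of restrictions
of a vector bundle on `𝒳`. [cite: GortzWedhorn2023, Thm 24.94, Prop 24.95 and Lemma 24.103]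
[cite: EGAIII1, Thm 5.1.4 and Cor 5.2.4] -/
theorem exists_isVectorBundle_forall_pullback_thickeningι_iso_of_isProjectiveOverRing
    (𝒳 : SchemeOver (WittVector p k)) (h𝒳 : Crystalline.IsProjectiveOverRing 𝒳)
    (E : ∀ n : ℕ, (thickening 𝒳 (n + 1)).left.Modules) (hE : ∀ n, IsVectorBundle (E n))
    (hcompat : ∀ n, Nonempty ((Scheme.Modules.pullback
      (thickeningMap 𝒳 (Nat.le_succ (n + 1)))).obj (E (n + 1)) ≅ E n)) :
    ∃ F : 𝒳.left.Modules, IsVectorBundle F ∧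
      ∀ n : ℕ, Nonempty ((Scheme.Modules.pullback (thickeningι 𝒳 (n + 1))).obj F ≅ E n) := by
  obtain ⟨r, ι, hι⟩ := h𝒳
  haveI : IsClosedImmersion (show 𝒳.left ⟶ PP (WittVector p k) r from ι.left) := hι
  exact exists_isVectorBundle_forall_pullback_thickeningι_iso_of_isClosedImmersion_PP 𝒳
    (show 𝒳.left ⟶ PP (WittVector p k) r from ι.left) (Over.w ι) E hE hcompat

/-- **`LiftsFormally ⟹ LiftsTo` on a projective `W(k)`-scheme, `k` perfect** — the vector-bundle
form of "Grothendieck's formal existence theorem gives an algebraization isomorphism"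
(Bloch–Esnault–Kerz 2014, §1 (1.3)): a module on the special fibre which lifts to a compatible system
of vector bundles on all thickenings is the restriction of a vector bundle on `𝒳` (restrict the
algebraization along `X_k ⟶ X_1 ⟶ 𝒳 = X_k ⟶ 𝒳`, `specialFibreToThickening_ι`).
[cite: BlochEsnaultKerz2014pAdic, §1 (1.3)] [cite: GortzWedhorn2023, Prop 24.95 (p. 566)] -/
theorem liftsTo_of_liftsFormally_of_isProjectiveOverRing {𝒳 : SchemeOver (WittVector p k)}
    (h𝒳 : Crystalline.IsProjectiveOverRing 𝒳) {E₁ : (specialFibre 𝒳).left.Modules}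
    (hE : LiftsFormally 𝒳 E₁) : LiftsTo 𝒳 E₁ := by
  obtain ⟨E, hEvb, hstep, ⟨e0⟩⟩ := hE
  obtain ⟨F, hF, e⟩ :=
    exists_isVectorBundle_forall_pullback_thickeningι_iso_of_isProjectiveOverRing 𝒳 h𝒳 E hEvb hstep
  obtain ⟨e1⟩ := e 0
  refine ⟨F, hF, ⟨?_⟩⟩
  exact (Scheme.Modules.pullbackCongr (specialFibreToThickening_ι 𝒳 0).symm).app F ≪≫
    (Scheme.Modules.pullbackComp (specialFibreToThickening 𝒳 0) (thickeningι 𝒳 1)).symm.app F ≪≫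
    (Scheme.Modules.pullback (specialFibreToThickening 𝒳 0)).mapIso e1 ≪≫ e0

/-- **The body of the named fact `GrothendieckExistence_vectorBundle_witt` holds for projective `𝒳`**
(level-`1` form; properness is implied by projectivity and is not assumed).
[cite: GortzWedhorn2023, Thm 24.94 and Prop 24.95 (p. 566)] -/
theorem grothendieckExistence_vectorBundle_witt_of_isProjectiveOverRing
    (𝒳 : SchemeOver (WittVector p k)) (h𝒳 : Crystalline.IsProjectiveOverRing 𝒳)
    (E : ∀ n : ℕ, (thickening 𝒳 (n + 1)).left.Modules) (hE : ∀ n, IsVectorBundle (E n))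
    (hcompat : ∀ n, Nonempty ((Scheme.Modules.pullback
      (thickeningMap 𝒳 (Nat.le_succ (n + 1)))).obj (E (n + 1)) ≅ E n)) :
    ∃ F : 𝒳.left.Modules, IsVectorBundle F ∧
      Nonempty ((Scheme.Modules.pullback (thickeningι 𝒳 1)).obj F ≅ E 0) := by
  obtain ⟨F, hF, e⟩ :=
    exists_isVectorBundle_forall_pullback_thickeningι_iso_of_isProjectiveOverRing 𝒳 h𝒳 E hE hcompat
  exact ⟨F, hF, e 0⟩

/-- **Route item `PadicSemiregularLift.FormalVectorBundlesAlgebraize` (stmt-HodgeConjecture-14106)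
restricted to PROJECTIVE smooth proper models holds unconditionally**: for `𝒳/W(k)` a smooth proper
model which is projective over `W(k)`, every module on the special fibre that lifts formally lifts
algebraically (of `IsSmoothProperModel` nothing is used). This is the form in which the route's
engine (`Theorems/PadicSemiregularLiftHodgeAbelianVarietiesStarSeedsEngine`) and the junction of
line `padic-disc-transport` of crux `AnchorTransport.VariationalHodge` consume the item — both carry
`IsProjectiveOverRing`. [cite: GortzWedhorn2023, Prop 24.95 (p. 566)]
[cite: BlochEsnaultKerz2014pAdic, §1 (1.3)] -/
theorem formalVectorBundlesAlgebraize_of_isProjectiveOverRing :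
    ∀ (p : ℕ) [Fact p.Prime] (k : Type u) [Field k] [CharP k p] [PerfectRing k p] (d : ℕ)
      (𝒳 : SchemeOver (WittVector p k)), IsSmoothProperModel d 𝒳 →
      Crystalline.IsProjectiveOverRing 𝒳 →
      ∀ (E₁ : (specialFibre 𝒳).left.Modules), LiftsFormally 𝒳 E₁ → LiftsTo 𝒳 E₁ :=
  fun _ _ _ _ _ _ _ _ _ h𝒳 _ hE => liftsTo_of_liftsFormally_of_isProjectiveOverRing h𝒳 hE

end Literature.AlgebraicGeometry.Motives

end
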